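import Summits.Ventures.HSemireg.WedgeHankelRecurrenceClasses

/-!
# Venture HSemireg — MACAULAY'S CORRESPONDENCE FOR CLASSES (the converse of the complete intersection, N56): **every coprime pair `(m, g)` with `0 ≠ m`, `deg m ≤ r`, `deg g ≤ N + 2 − r`
# and no common zero at `∞` (`deg m = r` or `deg g = N + 2 − r`), `1 ≤ r`, `2r ≤ N + 1`, IS the pair of generators of a class: there is `q` on `[0, N]` with `R^N(q) = r`, `m ∈ Rec^N_r(q)`,
# `g ∈ Rec^N_{N+2−r}(q)`, `g ∉ m·K[X]_{≤ N+2−2r}`, and `q` is UNIQUE UP TO A SCALAR** — the class is the linear form on `K[X]_{≤ N}` vanishing on the hyperplane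
# `m·K[X]_{≤ N−r} ⊕ g·K[X]_{≤ r−2}`

HONEST FRAMING. Part of the Lean index of the computation cell `pub-hsemireg` (seat p10 gen 29, Sunday typer «UNIFORM-IN-n»).
LINEAR ALGEBRA OF HANKEL (catalecticant) MATRICES and of polynomials over a field ONLY: no variety, no cohomology theory, no sheaf, no Ext group and no semiregularity map is constructed
here; nothing here says that HC / HC_CM / HC_AV holds; no Literature fact is declared or used.  Custodian versions as in `WedgeHankelSiegelIdeal` (1/3); the dictionary (Macaulay's inverse
systems: «complete intersections `(M, G)` of degrees `r + (N + 2 − r)` in `K[x, y]` ↔ binary forms of degree `N` up to scalar») is QUOTED, never asserted.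

WHAT IS IN THE TREE.  N18 (`WedgeHankelRecurrenceModule`, № 173): `hkFun` (a linear form on `K[X]`), `hkFun_monomial`, `hkFun_X_pow_mul`, `recSpace`, `mem_recSpace_iff`, `recSpace_eq_bot_of_lt`,
`exists_recSpace_self_eq_span`, `mem_recSpace_iff_exists_mul`, `dvd_of_mem_recSpace`, `map_mulRight_degreeLT_le_recSpace`, `finrank_map_mulRight_degreeLT`, `finrank_polynomial_degreeLT`,
`mem_degreeLT_succ_iff`, `recSpace_eq_degreeLT_of_lt`; N56 (№ 380) is the converse direction and is NOT imported (this leaf is PLAIN on N43/N18).  Mathlib: `Submodule.exists_le_ker_of_lt_top`,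
`Submodule.comap_subtype_eq_top`, `Polynomial.degreeLT.basis` / `basis_val`, `Basis.ext`, `Submodule.finrank_sup_add_finrank_inf_eq`, `Submodule.eq_of_le_of_finrank_eq`, `IsCoprime.isUnit_of_dvd'`,
`IsCoprime.dvd_of_dvd_mul_left/right`, `Polynomial.natDegree_eq_zero_of_isUnit`.
THIS FILE (namespace `Summit.Ventures.HSemireg.Wedge.HankelOuter` continued; PLAIN; 0 definitions).  `H(m, g) := (degreeLT K (N+1−r)).map (mulRight m) ⊔ (degreeLT K (r−1)).map (mulRight g)`
(= `m·K[X]_{≤ N−r} + g·K[X]_{≤ r−2}`, spelled out).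
* §593 LINEAR FORMS: `linearForm_exists_smul_of_ker_le` (two linear forms with nested kernels are proportional), `hkFun_zero_X_pow` (`⟪X^j, q⟫_0 = q_j`), **`mem_recSpace_level_iff`** (`Rec^N_N(q) = {P ∈ K[X]_{≤N} :
  ⟪P, q⟫_0 = 0}`), `finrank_recSpace_level` (`R^N(q) ≥ 1 ⇒ dim Rec^N_N(q) = N`).
* §594 THE HYPERPLANE OF A PAIR: `map_mulRight_le_degreeLT_of_natDegree_le` ×2 (both pieces lie in `K[X]_{≤ N}`), **`map_mulRight_inf_map_mulRight_eq_bot_of_isCoprime`** (the pieces are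
  independent when `gcd(m, g) = 1` and `deg m = r ∨ deg g = N + 2 − r`), **`finrank_hyperplane_of_isCoprime`** (`dim H(m, g) = N`), **`hyperplane_le_recSpace_level`** (`m ∈ Rec_r(q′)`,
  `g ∈ Rec_{N+2−r}(q′) ⇒ H(m, g) ≤ Rec^N_N(q′)`).
* §595 EXISTENCE **`exists_class_of_isCoprime`** (a class `q` with `R^N(q) = r`, `m ∈ Rec_r(q)`, `g ∈ Rec_{N+2−r}(q)`, `g ∉ m·K[X]_{≤ N+2−2r}`: `q_j := f(X^j)` for a non-zero linear form `f` on
  `K[X]_{≤ N}` killing `H(m, g)`; the rank is `r` because a shorter minimal recurrence would divide both `m` and `g`).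
* §596 UNIQUENESS **`exists_eq_smul_of_mem_recSpace`** (`R^N(q) = r ≥ 1`, `0 ≠ m ∈ Rec_r(q)`, `g ∈ Rec_{N+2−r}(q)`, `gcd = 1`, no common zero at `∞`, and `q′` with `m ∈ Rec_r(q′)`,
  `g ∈ Rec_{N+2−r}(q′) ⇒ q′ = c·q` on `[0, N]`).
Nothing Ext-side.  New names only.
-/

open Module Polynomial
open scoped Matrix Polynomial

namespace Summit.Ventures.HSemireg.Wedge.HankelOuter

open Summit.Ventures.HSemireg.Wedge Summit.Ventures.HSemireg.Wedge.Hankel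

variable (K : Type*) [Field K] {N : ℕ}

/-! ## §593. Linear forms and the top window -/

omit [Field K] in
/-- two linear forms with `ker f ≤ ker f′` are proportional: `f′ = c·f`. -/
theorem linearForm_exists_smul_of_ker_le {K V : Type*} [Field K] [AddCommGroup V] [Module K V] {f f' : V →ₗ[K] K} (h : LinearMap.ker f ≤ LinearMap.ker f') :
    ∃ c : K, ∀ v, f' v = c * f v := by
  by_cases hf : ∃ v, f v ≠ 0
  · obtain ⟨v, hv⟩ := hf
    refine ⟨f' v / f v, fun x => ?_⟩
    have hy : x - (f x / f v) • v ∈ LinearMap.ker f := by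
      rw [LinearMap.mem_ker, map_sub, map_smul, smul_eq_mul, div_mul_cancel₀ _ hv, sub_self]
    have hy' := h hy
    rw [LinearMap.mem_ker, map_sub, map_smul, smul_eq_mul, sub_eq_zero] at hy'
    rw [hy']; field_simp
  · refine ⟨0, fun x => ?_⟩
    have hx : x ∈ LinearMap.ker f := by
      rw [LinearMap.mem_ker]; by_contra hx; exact hf ⟨x, hx⟩
    have := h hx
    rw [LinearMap.mem_ker] at this
    rw [this, zero_mul]

/-- `⟪X^j, q⟫_0 = q_j`. -/
theorem hkFun_zero_X_pow (q : ℕ → K) (j : ℕ) : hkFun K q 0 (Polynomial.X ^ j) = q j := by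
  rw [Polynomial.X_pow_eq_monomial, hkFun_monomial, one_mul, add_zero]

/-- **THE TOP WINDOW: `P ∈ Rec^N_N(q) ⟺ deg P ≤ N ∧ ⟪P, q⟫_0 = 0`** (one equation). -/
theorem mem_recSpace_level_iff {q : ℕ → K} {P : K[X]} : P ∈ recSpace K N q N ↔ P ∈ Polynomial.degreeLT K (N + 1) ∧ hkFun K q 0 P = 0 := by
  rw [mem_recSpace_iff]
  exact ⟨fun h => ⟨h.1, h.2 0 (by omega)⟩, fun h => ⟨h.1, fun s hs => by rw [show s = 0 by omega]; exact h.2⟩⟩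

/-- `dim Rec^N_N(q) = N` as soon as `R^N(q) ≥ 1` (i.e. `q ≠ 0` on `[0, N]`). -/
theorem finrank_recSpace_level {q : ℕ → K} {r : ℕ} (hq : (hankel1 K N (N / 2) q).rank = r) (hr : 1 ≤ r) : finrank K (recSpace K N q N) = N := by
  rw [finrank_recSpace_eq_sub_min K le_rfl q, hq, min_eq_right (show N + 1 - N ≤ N + 1 by omega), min_eq_left (show N + 1 - N ≤ r by omega)]
  omega

/-! ## §594. The hyperplane `m·K[X]_{≤ N−r} ⊕ g·K[X]_{≤ r−2}` of a coprime pair -/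

/-- `deg m ≤ r ⇒ m·K[X]_{≤ N−r} ≤ K[X]_{≤ N}` (`r ≤ N + 1`). -/
theorem map_mulRight_le_degreeLT_of_natDegree_le {m : K[X]} {r : ℕ} (hm : m.natDegree ≤ r) (hrN : r ≤ N + 1) :
    (Polynomial.degreeLT K (N + 1 - r)).map (LinearMap.mulRight K m) ≤ Polynomial.degreeLT K (N + 1) := by
  rintro _ ⟨p, hp, rfl⟩
  rw [LinearMap.mulRight_apply]
  rcases eq_or_ne p 0 with rfl | hp0
  · rw [zero_mul]; exact Submodule.zero_mem _
  · have hpd := (Polynomial.natDegree_lt_iff_degree_lt hp0).mpr (Polynomial.mem_degreeLT.mp hp)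
    rw [mem_degreeLT_succ_iff]
    exact (Polynomial.natDegree_mul_le).trans (by omega)

/-- `deg g ≤ N + 2 − r`, `r ≤ N + 1 ⇒ g·K[X]_{≤ r−2} ≤ K[X]_{≤ N}`. -/
theorem map_mulRight_le_degreeLT_of_natDegree_le' {g : K[X]} {r : ℕ} (hg : g.natDegree ≤ N + 2 - r) (hr : 1 ≤ r) (hrN : r ≤ N + 1) :
    (Polynomial.degreeLT K (r - 1)).map (LinearMap.mulRight K g) ≤ Polynomial.degreeLT K (N + 1) := by
  rintro _ ⟨p, hp, rfl⟩
  rw [LinearMap.mulRight_apply]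
  rcases eq_or_ne p 0 with rfl | hp0
  · rw [zero_mul]; exact Submodule.zero_mem _
  · have hpd := (Polynomial.natDegree_lt_iff_degree_lt hp0).mpr (Polynomial.mem_degreeLT.mp hp)
    rw [mem_degreeLT_succ_iff]
    exact (Polynomial.natDegree_mul_le).trans (by omega)

/-- **THE TWO PIECES ARE INDEPENDENT: `m·K[X]_{≤ N−r} ⊓ g·K[X]_{≤ r−2} = 0` when `gcd(m, g) = 1` and `deg m = r` or `deg g = N + 2 − r`** (`m p = g ρ ⇒ g ∣ p`, `m ∣ ρ`; degrees). -/
theorem map_mulRight_inf_map_mulRight_eq_bot_of_isCoprime {m g : K[X]} {r : ℕ} (hcop : IsCoprime m g) (hinf : m.natDegree = r ∨ g.natDegree = N + 2 - r) :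
    (Polynomial.degreeLT K (N + 1 - r)).map (LinearMap.mulRight K m) ⊓ (Polynomial.degreeLT K (r - 1)).map (LinearMap.mulRight K g) = ⊥ := by
  rw [Submodule.eq_bot_iff]
  rintro x ⟨⟨p, hp, rfl⟩, ⟨ρ, hρ, hx⟩⟩
  simp only [LinearMap.mulRight_apply] at hx ⊢
  -- `ρ g = p m`
  have hgp : g ∣ p := hcop.symm.dvd_of_dvd_mul_right ⟨ρ, by rw [← hx, mul_comm]⟩
  have hmρ : m ∣ ρ := hcop.dvd_of_dvd_mul_right ⟨p, by rw [hx, mul_comm]⟩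
  rcases hinf with hmr | hgr
  · -- `deg ρ < r - 1 < deg m` forces `ρ = 0`, then `p m = 0`
    have hρ0 : ρ = 0 := by
      by_contra hρ0
      have hρd := (Polynomial.natDegree_lt_iff_degree_lt hρ0).mpr (Polynomial.mem_degreeLT.mp hρ)
      have := Polynomial.natDegree_le_of_dvd hmρ hρ0
      omega
    rw [hρ0, zero_mul] at hx
    rw [hx]
  · have hp0 : p = 0 := by
      by_contra hp0
      have hpd := (Polynomial.natDegree_lt_iff_degree_lt hp0).mpr (Polynomial.mem_degreeLT.mp hp)
      have := Polynomial.natDegree_le_of_dvd hgp hp0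
      omega
    rw [hp0, zero_mul]

/-- `g ≠ 0` under the standing hypotheses (`gcd(m, 0) = 1` would make `m` a unit, so `deg m = 0 ≠ r` and `deg 0 ≠ N + 2 − r`). -/
theorem ne_zero_of_isCoprime_of_natDegree {m g : K[X]} {r : ℕ} (hcop : IsCoprime m g) (hinf : m.natDegree = r ∨ g.natDegree = N + 2 - r) (hr : 1 ≤ r) (h2 : r + r ≤ N + 1) : g ≠ 0 := by
  rintro rfl
  rcases hinf with hmr | hgr
  · have hu : IsUnit m := isCoprime_zero_right.mp hcop
    have := Polynomial.natDegree_eq_zero_of_isUnit hu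
    omega
  · rw [Polynomial.natDegree_zero] at hgr; omega

/-- **`dim (m·K[X]_{≤ N−r} ⊕ g·K[X]_{≤ r−2}) = N`: a hyperplane of `K[X]_{≤ N}`.** -/
theorem finrank_hyperplane_of_isCoprime {m g : K[X]} {r : ℕ} (hcop : IsCoprime m g) (hinf : m.natDegree = r ∨ g.natDegree = N + 2 - r) (hm0 : m ≠ 0) (hr : 1 ≤ r) (h2 : r + r ≤ N + 1) :
    finrank K ↥((Polynomial.degreeLT K (N + 1 - r)).map (LinearMap.mulRight K m) ⊔ (Polynomial.degreeLT K (r - 1)).map (LinearMap.mulRight K g)) = N := by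
  have hg0 := ne_zero_of_isCoprime_of_natDegree K (N := N) hcop hinf hr h2
  have hsum := Submodule.finrank_sup_add_finrank_inf_eq ((Polynomial.degreeLT K (N + 1 - r)).map (LinearMap.mulRight K m)) ((Polynomial.degreeLT K (r - 1)).map (LinearMap.mulRight K g))
  rw [map_mulRight_inf_map_mulRight_eq_bot_of_isCoprime K hcop hinf, finrank_bot, Nat.add_zero, finrank_map_mulRight_degreeLT K hm0, finrank_map_mulRight_degreeLT K hg0] at hsum
  omega

/-- **THE HYPERPLANE LIES IN THE TOP WINDOW OF EVERY CLASS WITH THESE RECURRENCES: `m ∈ Rec_r(q′)`, `g ∈ Rec_{N+2−r}(q′) ⇒ m·K[X]_{≤ N−r} ⊕ g·K[X]_{≤ r−2} ≤ Rec^N_N(q′)`** (shifts, N18). -/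
theorem hyperplane_le_recSpace_level {m g : K[X]} {r : ℕ} {q' : ℕ → K} (hr : 1 ≤ r) (hrN : r ≤ N) (hm : m ∈ recSpace K N q' r) (hg : g ∈ recSpace K N q' (N + 2 - r)) :
    (Polynomial.degreeLT K (N + 1 - r)).map (LinearMap.mulRight K m) ⊔ (Polynomial.degreeLT K (r - 1)).map (LinearMap.mulRight K g) ≤ recSpace K N q' N := by
  refine sup_le ?_ ?_
  · have h := map_mulRight_degreeLT_le_recSpace K hm (N - r)
    rwa [show N - r + 1 = N + 1 - r by omega, show r + (N - r) = N by omega] at h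
  · rcases Nat.lt_or_ge 1 r with h1 | h1
    · have h := map_mulRight_degreeLT_le_recSpace K hg (r - 2)
      rwa [show r - 2 + 1 = r - 1 by omega, show N + 2 - r + (r - 2) = N by omega] at h
    · rw [show r - 1 = 0 by omega]
      rintro _ ⟨p, hp, rfl⟩
      rw [SetLike.mem_coe, Polynomial.mem_degreeLT, Nat.cast_zero, Nat.WithBot.lt_zero_iff, Polynomial.degree_eq_bot] at hp
      rw [hp, map_zero]; exact Submodule.zero_mem _

/-! ## §595. Existence: the class of a coprime pair -/

/-- **MACAULAY'S CORRESPONDENCE, EXISTENCE: for `1 ≤ r`, `2r ≤ N + 1`, `0 ≠ m` with `deg m ≤ r`, `g` with `deg g ≤ N + 2 − r`, `gcd(m, g) = 1` and (`deg m = r` or `deg g = N + 2 − r`), there is a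
class `q` on `[0, N]` with `R^N(q) = r`, `m ∈ Rec^N_r(q)`, `g ∈ Rec^N_{N+2−r}(q)` and `g ∉ m·K[X]_{≤ N+2−2r}`** (`q_j := f(X^j)` for a non-zero linear form `f` on `K[X]_{≤ N}` vanishing on the
hyperplane `m·K[X]_{≤ N−r} ⊕ g·K[X]_{≤ r−2}`; a minimal recurrence of degree `< r` would divide `m` and `g`, so be a unit, and bound both degrees strictly). -/
theorem exists_class_of_isCoprime {m g : K[X]} {r : ℕ} (hr : 1 ≤ r) (h2 : r + r ≤ N + 1) (hm0 : m ≠ 0) (hmr : m.natDegree ≤ r) (hgr : g.natDegree ≤ N + 2 - r) (hcop : IsCoprime m g)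
    (hinf : m.natDegree = r ∨ g.natDegree = N + 2 - r) :
    ∃ q : ℕ → K, (hankel1 K N (N / 2) q).rank = r ∧ m ∈ recSpace K N q r ∧ g ∈ recSpace K N q (N + 2 - r) ∧ g ∉ (Polynomial.degreeLT K (N + 2 - r - r + 1)).map (LinearMap.mulRight K m) := by
  -- the hyperplane inside `V = K[X]_{≤ N}`
  set V : Submodule K K[X] := Polynomial.degreeLT K (N + 1) with hV
  set H : Submodule K K[X] := (Polynomial.degreeLT K (N + 1 - r)).map (LinearMap.mulRight K m) ⊔ (Polynomial.degreeLT K (r - 1)).map (LinearMap.mulRight K g) with hH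
  have hHV : H ≤ V := sup_le (map_mulRight_le_degreeLT_of_natDegree_le K hmr (by omega)) (map_mulRight_le_degreeLT_of_natDegree_le' K hgr hr (by omega))
  have hHdim : finrank K H = N := finrank_hyperplane_of_isCoprime K hcop hinf hm0 hr h2
  have hlt : H.comap V.subtype < ⊤ := by
    refine lt_top_iff_ne_top.mpr fun htop => ?_
    rw [Submodule.comap_subtype_eq_top] at htop
    have h1 := Submodule.finrank_mono htop
    rw [hHdim, hV, finrank_polynomial_degreeLT] at h1
    omega
  obtain ⟨f, hf0, hfker⟩ := Submodule.exists_le_ker_of_lt_top _ hlt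
  -- the class
  let q : ℕ → K := fun j => if h : j < N + 1 then f (Polynomial.degreeLT.basis K (N + 1) ⟨j, h⟩) else 0
  have hfq : f = (hkFun K q 0).comp V.subtype := by
    refine (Polynomial.degreeLT.basis K (N + 1)).ext fun i => ?_
    rw [LinearMap.comp_apply, Submodule.subtype_apply, Polynomial.degreeLT.basis_val, hkFun_zero_X_pow]
    simp only [q, dif_pos i.2]
  have hfP : ∀ {P : K[X]} (hP : P ∈ V), hkFun K q 0 P = f ⟨P, hP⟩ := fun hP => by rw [hfq]; rfl
  have hHker : ∀ {P : K[X]}, P ∈ H → hkFun K q 0 P = 0 := fun {P} hP => by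
    rw [hfP (hHV hP)]
    exact LinearMap.mem_ker.mp (hfker (show (⟨P, hHV hP⟩ : V) ∈ H.comap V.subtype from hP))
  -- `m ∈ Rec_r(q)`
  have hmq : m ∈ recSpace K N q r := by
    rw [mem_recSpace_iff]
    refine ⟨(mem_degreeLT_succ_iff K).mpr hmr, fun s hs => ?_⟩
    rw [← zero_add s, ← hkFun_X_pow_mul]
    refine hHker (Submodule.mem_sup_left ⟨Polynomial.X ^ s, ?_, by rw [LinearMap.mulRight_apply]⟩)
    rw [SetLike.mem_coe, show N + 1 - r = N - r + 1 by omega, mem_degreeLT_succ_iff]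
    exact (Polynomial.natDegree_pow_le).trans (by rw [Polynomial.natDegree_X, mul_one]; omega)
  -- `g ∈ Rec_{N+2-r}(q)`
  have hgq : g ∈ recSpace K N q (N + 2 - r) := by
    rcases Nat.lt_or_ge 1 r with h1 | h1
    · rw [mem_recSpace_iff]
      refine ⟨(mem_degreeLT_succ_iff K).mpr hgr, fun s hs => ?_⟩
      rw [← zero_add s, ← hkFun_X_pow_mul]
      refine hHker (Submodule.mem_sup_right ⟨Polynomial.X ^ s, ?_, by rw [LinearMap.mulRight_apply]⟩)
      rw [SetLike.mem_coe, show r - 1 = r - 2 + 1 by omega, mem_degreeLT_succ_iff]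
      exact (Polynomial.natDegree_pow_le).trans (by rw [Polynomial.natDegree_X, mul_one]; omega)
    · rw [recSpace_eq_degreeLT_of_lt K (show N < N + 2 - r by omega)]
      exact (mem_degreeLT_succ_iff K).mpr hgr
  -- the rank is `r`
  have hR : (hankel1 K N (N / 2) q).rank = r := by
    set R := (hankel1 K N (N / 2) q).rank with hRdef
    have hRle : R ≤ r := by
      by_contra hlt'
      have hbot := recSpace_eq_bot_of_lt K hRdef.symm (show r < R by omega)
      rw [hbot, Submodule.mem_bot] at hmq
      exact hm0 hmq
    have hR1 : 1 ≤ R := by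
      by_contra hR0
      have hq0 := (rank_hankel1_half_eq_zero_iff K (N := N) q).mp (by omega)
      refine hf0 ((Polynomial.degreeLT.basis K (N + 1)).ext fun i => ?_)
      rw [hfq, LinearMap.comp_apply, Submodule.subtype_apply, Polynomial.degreeLT.basis_val, hkFun_zero_X_pow, LinearMap.zero_apply]
      exact hq0 i (by have := i.2; omega)
    by_contra hne
    have hRlt : R < r := by omega
    obtain ⟨m₀, hm₀0, hspan⟩ := exists_recSpace_self_eq_span K hRdef.symm (by omega)
    have hm₀ : m₀ ∈ recSpace K N q R := by rw [hspan]; exact Submodule.mem_span_singleton_self m₀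
    have hdm : m₀ ∣ m := dvd_of_mem_recSpace K hRdef.symm (by omega) hm₀ hm₀0 hmq
    have hdg : m₀ ∣ g := dvd_of_mem_recSpace K hRdef.symm (by omega) hm₀ hm₀0 hgq
    have hu : IsUnit m₀ := hcop.isUnit_of_dvd' hdm hdg
    have hd0 : m₀.natDegree = 0 := Polynomial.natDegree_eq_zero_of_isUnit hu
    -- both degrees are too small
    obtain ⟨d, hd⟩ := Nat.exists_eq_add_of_lt hRlt
    have hmdeg : m.natDegree < r := by
      have hmq' : m ∈ recSpace K N q (R + (d + 1)) := by rw [show R + (d + 1) = r by omega]; exact hmq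
      obtain ⟨h, hh, hhm⟩ := (mem_recSpace_iff_exists_mul K hRdef.symm (by omega) hm₀ hm₀0).mp hmq'
      rw [← hhm]
      rcases eq_or_ne h 0 with rfl | hh0
      · rw [zero_mul, Polynomial.natDegree_zero]; omega
      · rw [Polynomial.natDegree_mul hh0 hm₀0, hd0]
        have := (mem_degreeLT_succ_iff K).mp hh; omega
    have hgdeg : g.natDegree < N + 2 - r := by
      have hgq' : g ∈ recSpace K N q (R + (N + 2 - r - R)) := by rw [show R + (N + 2 - r - R) = N + 2 - r by omega]; exact hgq
      obtain ⟨h, hh, hhg⟩ := (mem_recSpace_iff_exists_mul K hRdef.symm (by omega) hm₀ hm₀0).mp hgq'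
      rw [← hhg]
      rcases eq_or_ne h 0 with rfl | hh0
      · rw [zero_mul, Polynomial.natDegree_zero]; omega
      · rw [Polynomial.natDegree_mul hh0 hm₀0, hd0]
        have := (mem_degreeLT_succ_iff K).mp hh; omega
    rcases hinf with h | h <;> omega
  refine ⟨q, hR, hmq, hgq, ?_⟩
  -- `g` is not accounted for by `m`
  rintro ⟨h, hh, hhg⟩
  rw [LinearMap.mulRight_apply] at hhg
  have hu : IsUnit m := hcop.isUnit_of_dvd' (dvd_refl m) ⟨h, by rw [← hhg, mul_comm]⟩
  have hd0 : m.natDegree = 0 := Polynomial.natDegree_eq_zero_of_isUnit hu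
  rcases hinf with hmr' | hgr'
  · omega
  · rw [← hhg] at hgr'
    rcases eq_or_ne h 0 with rfl | hh0
    · rw [zero_mul, Polynomial.natDegree_zero] at hgr'; omega
    · rw [Polynomial.natDegree_mul hh0 hm0, hd0] at hgr'
      have := (mem_degreeLT_succ_iff K).mp hh
      omega

/-! ## §596. Uniqueness up to a scalar -/

/-- **MACAULAY'S CORRESPONDENCE, UNIQUENESS: if `R^N(q) = r ≥ 1` (`2r ≤ N + 1`), `0 ≠ m ∈ Rec_r(q)`, `g ∈ Rec_{N+2−r}(q)`, `gcd(m, g) = 1` and (`deg m = r` or `deg g = N + 2 − r`), then every `q′`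
with `m ∈ Rec_r(q′)` and `g ∈ Rec_{N+2−r}(q′)` is `c·q` on `[0, N]`** (both top windows contain the hyperplane `m·K[X]_{≤ N−r} ⊕ g·K[X]_{≤ r−2}`; `Rec^N_N(q)` IS it by dimension; linear forms
with nested kernels are proportional).  No degree bounds on `m`, `g` are needed here: membership in the windows bounds them. -/
theorem exists_eq_smul_of_mem_recSpace {m g : K[X]} {r : ℕ} {q q' : ℕ → K} (hq : (hankel1 K N (N / 2) q).rank = r) (hr : 1 ≤ r) (h2 : r + r ≤ N + 1) (hm0 : m ≠ 0)
    (hcop : IsCoprime m g) (hinf : m.natDegree = r ∨ g.natDegree = N + 2 - r) (hm : m ∈ recSpace K N q r) (hg : g ∈ recSpace K N q (N + 2 - r)) (hm' : m ∈ recSpace K N q' r) (hg' : g ∈ recSpace K N q' (N + 2 - r)) :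
    ∃ c : K, ∀ j ≤ N, q' j = c * q j := by
  set V : Submodule K K[X] := Polynomial.degreeLT K (N + 1) with hV
  set H : Submodule K K[X] := (Polynomial.degreeLT K (N + 1 - r)).map (LinearMap.mulRight K m) ⊔ (Polynomial.degreeLT K (r - 1)).map (LinearMap.mulRight K g) with hH
  haveI := finiteDimensional_recSpace K (N := N) q N
  -- `Rec^N_N(q) = H`
  have hHeq : H = recSpace K N q N :=
    Submodule.eq_of_le_of_finrank_eq (hyperplane_le_recSpace_level K hr (by omega) hm hg) (by rw [finrank_hyperplane_of_isCoprime K hcop hinf hm0 hr h2, finrank_recSpace_level K hq hr])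
  have hH' : H ≤ recSpace K N q' N := hyperplane_le_recSpace_level K hr (by omega) hm' hg'
  -- the two linear forms on `V`
  have hker : LinearMap.ker ((hkFun K q 0).comp V.subtype) ≤ LinearMap.ker ((hkFun K q' 0).comp V.subtype) := by
    intro P hP
    rw [LinearMap.mem_ker, LinearMap.comp_apply, Submodule.subtype_apply] at hP ⊢
    have hPq : (P : K[X]) ∈ recSpace K N q N := (mem_recSpace_level_iff K).mpr ⟨P.2, hP⟩
    rw [← hHeq] at hPq
    exact ((mem_recSpace_level_iff K).mp (hH' hPq)).2
  obtain ⟨c, hc⟩ := linearForm_exists_smul_of_ker_le hker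
  refine ⟨c, fun j hj => ?_⟩
  have hXj : (Polynomial.X : K[X]) ^ j ∈ V := (mem_degreeLT_succ_iff K).mpr ((Polynomial.natDegree_pow_le).trans (by rw [Polynomial.natDegree_X, mul_one]; exact hj))
  have h := hc ⟨Polynomial.X ^ j, hXj⟩
  simp only [LinearMap.comp_apply, Submodule.subtype_apply, hkFun_zero_X_pow] at h
  exact h

end Summit.Ventures.HSemireg.Wedge.HankelOuter
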